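import Summits.ABC.ABC.Theses.DefiniteXi
import Summits.ABC.ABC.Theorems.DefiniteXiFreyModularity
import Summits.ABC.ABC.Theorems.DefiniteXiDefiniteRTControlPrimeSmulTransportDeg
import Summits.ABC.ABC.Theorems.DefiniteXiDefiniteRTControlPrimeValTransport
import Summits.ABC.ABC.Theorems.DefiniteXiDefiniteRTControlPrimeFreyScale
import Summits.ABC.ABC.Theorems.DefiniteXiDefiniteRTControlPrimeFreyLocal
import Literature.NumberTheory.EllipticCurves.TakahashiDegreeFormulaCoprimeProofs
import Literature.NumberTheory.EllipticCurves.PastenSpectralDegree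
import Literature.NumberTheory.EllipticCurves.PastenHeightBounds
import Literature.NumberTheory.EllipticCurves.PastenHeightBoundsLemma68LocalProofs
import Literature.NumberTheory.EllipticCurves.PastenSpectralDegreeIsogenyBoundProofs
import Literature.NumberTheory.EllipticCurves.ModularCurveManinSemistableBridgeProofs
import Literature.NumberTheory.EllipticCurves.ModularDegreeMinimal
import Literature.NumberTheory.EllipticCurves.IsogenyVariableChangeProofs
import Literature.NumberTheory.EllipticCurves.IsogenyCompProofs
import Literature.NumberTheory.EllipticCurves.IsogenyDualProofs
import Literature.NumberTheory.Automorphic.ShimuraCurveTakahashiCoordinateInputs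
import Literature.NumberTheory.Automorphic.ShimuraParametrizationSplitDegreeProofs
import Literature.NumberTheory.Automorphic.ShimuraCurveDataExistence
import HarnessLib

/-!
# stub_takahashi (crux `DefiniteXi.DefiniteRTControlPrime`, stmt-ABC-11338) — gen-4 k1 companion:
# the BSD twin `takahashi2001_thm_2_3_shimura_level` feeds the skeleton DIRECTLY at the
# lattice-optimal node `(W₀, D₀)` — no conductor-restricted pivot `(W⋆, P⋆)`, no Carayol /
# `LevelIsConductor`, no ABC-only fact `takahashi2001_thm_2_3_of_coprime`

FAMILY 1 (recognise & import), tree match.  The skeleton's composition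
`definiteRTControlPrime_of_facts` uses Takahashi only at the conductor-restricted optimal pivot
`(W⋆, P⋆)` (`exists_conductorMinimal`), because the ABC idiom `takahashi2001_thm_2_3_of_coprime`
quantifies minimality over conductor-`Mr` curves.  The twin's idiom is
`ShimuraParametrizationData.IsMinimalFor` = minimality over the ISOGENY CLASS, and the skeleton
already produces a class-minimal classical datum: the lattice-optimal `D₀` on `W₀`
(`exists_optimalDatum'` + `modularDegree_le_of_isogenyMap_ker_eq_bot`).  So the twin applies at
`(W₀, D₀)` with reference curve the global minimal model `C • E` (conductor `N` by hypothesis),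
through the tree's `X₀^1(N) = X₀(N)` bridges — and the pivot, the inequality
`deg D₀ ≤ deg P⋆`, and every conductor hypothesis on the carrier disappear.

* `isMinimalFor_of_classMinimal'` (A1) — class-minimal classical `D₀` on `W₀`, a Shimura datum `Q`
  on `W₀` with `Q.deg = deg D₀`, any `V ~ W₀` with newform `D₀.f` ⇒ `Q.IsMinimalFor V`
  (tree: `ShimuraParametrizationData.modularDegree_dvd_deg`; gen-3 H3 with a free reference curve).
* `modularDegree_le_xi_mul_of_twin` (A2) / `modularDegree_le_brandtXi_mul_of_twin` (A2') —
  `deg D₀ ≤ ξ_S(a(W₀)) · v_q(Δ_min W₀)` for every setup `S` of type `(M, q)` / for `brandtXi M q`,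
  from the twin at `(N, D, M, p, m) = (Mq, 1, Mq, q, M)` (tree: `nonempty_shimuraCurveData_holds`,
  `isAdmissibleFactorization_one`, `exists_shimuraParametrizationData_deg_eq_modularDegree`,
  `takahashi2001_thm_2_3_shimura_level.deg_le_xi_mul`, `exists_brandtXi_eq`,
  `takahashi2001_thm_2_3_of_coprime.nonempty_xiSetup'`).
* `definiteRTControlPrime_of_twin` (A3) — the crux from the TWIN + Pasten's `163`-fact + Lemma 6.8,
  same constant `C = 4·163²`: the composition of `definiteRTControlPrime_of_facts` with the
  `(W⋆, P⋆)` block replaced by A2' at `(C • E, W₀, D₀)`.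

(Imports = those of `Theorems/DefiniteXiDefiniteRTControlPrime.lean`, whose module itself is
not in the farm snapshot today; its helper `isIsogenous_of_f_eq` is re-proved here verbatim.)
`lean check` (farm, 2026-08-31): rc 0, **0 sorries**, axioms of `definiteRTControlPrime_of_twin` =
`propext, Classical.choice, Quot.sound`.  Plan: `STUB-IDEAS-stub_takahashi-1.md` (gen 4).
-/

noncomputable section

namespace Summit.ABC.ABC.Cruxes.DefiniteRTControlPrime.StubIdeas1G4

open Summit.ABC.ABC.Theses.DefiniteXi
open Summit.ABC.ABC.Theorems.DefiniteRTControlPrime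
open Literature.NumberTheory.EllipticCurves Literature.NumberTheory.EllipticCurves.ModularForms
open Literature.NumberTheory.Automorphic
open WeierstrassCurve

/-- (copy of `Theorems/DefiniteXiDefiniteRTControlPrime.isIsogenous_of_f_eq`) Two elliptic curves
over `ℚ` carrying data with the same newform are `ℚ`-isogenous — both are isogenous to the
lattice-optimal curve of the class. [folklore] -/
theorem isIsogenous_of_f_eq' {W W' : WeierstrassCurve ℚ} [W.IsElliptic] [W'.IsElliptic] {N : ℕ}
    [NeZero N] (D : ModularParametrizationData W N) (D' : ModularParametrizationData W' N)
    (hf : D'.f = D.f) : W.IsIsogenous W' := by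
  obtain ⟨W₀, hW₀, D₀, hf₀, h₀⟩ := D.exists_optimalDatum'
  haveI := hW₀
  have key : ∀ {V : WeierstrassCurve ℚ} [V.IsElliptic] (P : ModularParametrizationData V N),
      P.f = D₀.f → W₀.IsIsogenous V := by
    intro V _ P hP
    have hc₀ : (D₀.c : ℚ) ≠ 0 := by exact_mod_cast D₀.maninConstant_ne_zero_holds
    have hc : (P.c : ℚ) ≠ 0 := by exact_mod_cast P.maninConstant_ne_zero_holds
    refine isIsogenous_of_forall_mul_mem_lattice D₀.isNeronLattice.1 D₀.isNeronLattice.2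
      P.isNeronLattice.1 P.isNeronLattice.2 (c := (P.c : ℚ) / D₀.c) (div_ne_zero hc hc₀) ?_
    intro z hz
    obtain ⟨w, hw, rfl⟩ := h₀ z hz
    have hw' : w ∈ periodLattice P.f := by rw [hP]; exact hw
    have : (((P.c : ℚ) / D₀.c : ℚ) : ℂ) * ((D₀.c : ℂ) * w) = (P.c : ℂ) * w := by
      have hc₀' : (D₀.c : ℂ) ≠ 0 := D₀.cast_c_ne_zero
      push_cast
      field_simp
    rw [this]
    exact P.smul_periodLattice_le w hw'
  have h1 : W₀.IsIsogenous W := key D hf₀.symm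
  have h2 : W₀.IsIsogenous W' := key D' (hf.trans hf₀.symm)
  exact h1.symm_of_charZero.trans' h2

/-- **A1.** A class-minimal classical datum `D₀` on `W₀` (minimal degree among ALL data at level
`N` with newform `D₀.f`), a Shimura datum `Q` on `W₀` over an `X : ShimuraCurveData 1 N` with
`Q.deg = deg D₀`, and any elliptic `V` `ℚ`-isogenous to `W₀` carrying the newform `D₀.f`:
`Q` realises `δ_{1,N}` of the class of `V` (`Q.IsMinimalFor V`). [folklore] -/
theorem isMinimalFor_of_classMinimal' {N : ℕ} [NeZero N] {X : ShimuraCurveData 1 N}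
    {V W₀ : WeierstrassCurve ℚ} [V.IsElliptic] [W₀.IsElliptic]
    (D₀ : ModularParametrizationData W₀ N)
    (hmin₀ : ∀ (W₂ : WeierstrassCurve ℚ) [W₂.IsElliptic] (D₂ : ModularParametrizationData W₂ N),
      D₂.f = D₀.f → D₀.modularDegree ≤ D₂.modularDegree)
    (hiso : V.IsIsogenous W₀) (hf : IsNewformOf V D₀.f)
    (Q : ShimuraParametrizationData X W₀) (hQ : Q.deg = D₀.modularDegree) : Q.IsMinimalFor V :=
  ⟨hiso, fun W'' _ P'' hiso'' => by
    rw [hQ]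
    exact Nat.le_of_dvd P''.deg_pos (P''.modularDegree_dvd_deg hiso'' D₀ hf hmin₀)⟩

/-- **A2.** `deg D₀ ≤ ξ_S(a(W₀)) · v_q(Δ_min(W₀))` for a class-minimal classical datum `D₀` on `W₀`
at level `M q` (`q` prime, `gcd(M, q) = 1`), in EVERY Brandt setup `S` of type `(M, q)`, given a
reference curve `V ~ W₀` of conductor `M q` carrying `D₀.f` — from the BSD twin
`takahashi2001_thm_2_3_shimura_level` at `D = 1` through the `X₀^1 = X₀` bridges; no conductor
hypothesis on `W₀`, no Carayol. [cite: Takahashi2001, Thm. 2.3 (p. 79), remark p. 80] -/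
theorem modularDegree_le_xi_mul_of_twin (hT : takahashi2001_thm_2_3_shimura_level)
    {M q : ℕ} [NeZero (M * q)] (hq : q.Prime) (hcop : M.Coprime q)
    (V : WeierstrassCurve ℚ) [V.IsElliptic] (hV : V.conductorNorm ℤ = M * q)
    {W₀ : WeierstrassCurve ℚ} [W₀.IsElliptic] (D₀ : ModularParametrizationData W₀ (M * q))
    (hmin₀ : ∀ (W₂ : WeierstrassCurve ℚ) [W₂.IsElliptic]
      (D₂ : ModularParametrizationData W₂ (M * q)), D₂.f = D₀.f →
        D₀.modularDegree ≤ D₂.modularDegree)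
    (hiso : V.IsIsogenous W₀) (hf : IsNewformOf V D₀.f) (S : Brandt.XiSetup M q) :
    D₀.modularDegree ≤
      S.xi (fun n => W₀.LFunction n) * (W₀.minimalDiscriminantNorm ℤ).factorization q := by
  have hpos : 0 < M * q := Nat.pos_of_ne_zero (NeZero.ne _)
  have hadm : IsAdmissibleFactorization (M * q) 1 (M * q) := isAdmissibleFactorization_one hpos
  obtain ⟨X⟩ := nonempty_shimuraCurveData_holds hadm
  obtain ⟨Q, hQ⟩ := exists_shimuraParametrizationData_deg_eq_modularDegree X D₀
  have hQmin : Q.IsMinimalFor V := isMinimalFor_of_classMinimal' D₀ hmin₀ hiso hf Q hQ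
  have hqM : ¬ q ∣ M := by
    intro h
    have hg : Nat.gcd M q = 1 := hcop
    have h1 : q ∣ Nat.gcd M q := Nat.dvd_gcd h (dvd_refl q)
    rw [hg] at h1
    exact hq.one_lt.ne' (Nat.dvd_one.mp h1)
  have key := takahashi2001_thm_2_3_shimura_level.deg_le_xi_mul hT hq (Nat.mul_comm M q) hqM
    hadm X V hV W₀ Q hQmin
  rw [Nat.one_mul] at key
  rw [← hQ]
  exact key S

/-- **A2'.** The same with the setup-free `brandtXi M q` (the skeleton's currency). [cite: Takahashi2001, Thm. 2.3 (p. 79)] -/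
theorem modularDegree_le_brandtXi_mul_of_twin (hT : takahashi2001_thm_2_3_shimura_level)
    {M q : ℕ} [NeZero (M * q)] (hq : q.Prime) (hcop : M.Coprime q)
    (V : WeierstrassCurve ℚ) [V.IsElliptic] (hV : V.conductorNorm ℤ = M * q)
    {W₀ : WeierstrassCurve ℚ} [W₀.IsElliptic] (D₀ : ModularParametrizationData W₀ (M * q))
    (hmin₀ : ∀ (W₂ : WeierstrassCurve ℚ) [W₂.IsElliptic]
      (D₂ : ModularParametrizationData W₂ (M * q)), D₂.f = D₀.f →
        D₀.modularDegree ≤ D₂.modularDegree)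
    (hiso : V.IsIsogenous W₀) (hf : IsNewformOf V D₀.f) :
    D₀.modularDegree ≤
      brandtXi M q (fun n => W₀.LFunction n) * (W₀.minimalDiscriminantNorm ℤ).factorization q := by
  obtain ⟨S, hS⟩ := exists_brandtXi_eq (takahashi2001_thm_2_3_of_coprime.nonempty_xiSetup' hq hcop)
    (fun n => W₀.LFunction n)
  rw [hS]
  exact modularDegree_le_xi_mul_of_twin hT hq hcop V hV D₀ hmin₀ hiso hf S

/-- **A3. `DefiniteRTControlPrime` from the BSD twin, Pasten's `163`-fact and Lemma 6.8**, with
`C = 4 · 163²` and the `N^ε` idle — the chain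
`deg D ≤ 4 deg D₁ ≤ 4·163 deg D₀ ≤ 4·163 ξ v_q(Δ_min W₀) ≤ 4·163² ξ v_q(Δ_min E)`
(no pivot `(W⋆, P⋆)`: Takahashi is applied at the lattice-optimal `(W₀, D₀)` itself, reference
curve `C • E`). CONDITIONAL on exactly these three facts; the twin is the hypothesis `hTlev` the BSD
summit already carries (stmt-BSD-19716), so the two summits share ONE Takahashi debt.
[cite: Takahashi2001, Thm. 2.3 (p. 79), remark p. 80, Thm. 3.8 (p. 84)]
[cite: PastenShimura2024, §3 p. 13 and Lemma 6.8 (p. 22)] -/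
theorem definiteRTControlPrime_of_twin (hT : takahashi2001_thm_2_3_shimura_level)
    (h163 : PastenShimura2024_minimalDegree_le_163_mul) (h68 : PastenShimura2024_lemma_6_8) :
    DefiniteRTControlPrime := by
  intro ε hε
  refine ⟨4 * 163 * 163, ?_⟩
  intro a b hab h0 N _ hN q hq hq2 hqN D hDmin
  -- `N = M q`
  obtain ⟨M, hM⟩ := hqN
  rw [mul_comm] at hM
  subst hM
  haveI := isElliptic_freyCurve h0
  have hdiv : M * q / q = M := Nat.mul_div_cancel M hq.pos
  rw [hdiv]
  have hqN' : q ∣ (freyCurve a b).conductorNorm ℤ := by rw [hN]; exact Dvd.intro_left M rfl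
  -- `gcd(M, q) = 1`
  have hcop : M.Coprime q := by
    have h := stub_freyLocal a b hab h0 q hq hq2 hqN'
    rwa [hN, hdiv] at h
  -- a global minimal model `W_m = C • E`, its data, a minimal one
  obtain ⟨C, hC⟩ := hasGlobalMinimalModel_rat_holds (freyCurve a b)
  haveI := hC
  have hNm : (C • freyCurve a b).conductorNorm ℤ = M * q := by rw [conductorNorm_smul_rat, hN]
  have hne : Nonempty (ModularParametrizationData (C • freyCurve a b) (M * q)) :=
    (Summit.ABC.ABC.Theorems.nonempty_modularParametrizationData_smul_iff C).mpr ⟨D⟩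
  obtain ⟨D₁, -, hD₁min⟩ := exists_minimal_datum hne
  -- the lattice-optimal datum of the class of `f₁ := D₁.f`
  obtain ⟨W₀, hW₀, D₀, hf₀, h₀⟩ := D₁.exists_optimalDatum'
  haveI := hW₀
  have hker₀ : D₀.isogenyMap.ker = ⊥ := D₀.isogenyMap_ker_eq_bot_iff.mpr h₀
  have hmin₀ : ∀ (W' : WeierstrassCurve ℚ) [W'.IsElliptic]
      (D' : ModularParametrizationData W' (M * q)), D'.f = D₀.f →
        D₀.modularDegree ≤ D'.modularDegree := fun W' _ D' hD' =>
    D₀.modularDegree_le_of_isogenyMap_ker_eq_bot hker₀ D' hD'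
  -- (T_deg) `deg D₁ ≤ 163 · deg D₀`
  have h163' : D₁.modularDegree ≤ 163 * D₀.modularDegree :=
    h163 (M * q) W₀ (C • freyCurve a b) D₀ D₁ hf₀.symm hmin₀ hD₁min
  -- Takahashi (the twin at `D = 1`) at `(W₀, D₀)` itself, reference curve `W_m = C • E`
  have hisoW : (C • freyCurve a b).IsIsogenous W₀ := isIsogenous_of_f_eq' D₁ D₀ hf₀
  have hfW : IsNewformOf (C • freyCurve a b) D₀.f := by rw [hf₀]; exact D₁.isNewformOf
  have hTak : D₀.modularDegree ≤ brandtXi M q (fun n => W₀.LFunction n) *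
      (W₀.minimalDiscriminantNorm ℤ).factorization q :=
    modularDegree_le_brandtXi_mul_of_twin hT hq hcop (C • freyCurve a b) hNm D₀ hmin₀ hisoW hfW
  -- `a(W₀) = a(f₁) = a(W_m) = a(E)`
  have hL : (fun n => W₀.LFunction n) = fun n => (freyCurve a b).LFunction n := by
    funext n
    have h1 := D₀.isNewformOf.2 n
    have h2 := D₁.isNewformOf.2 n
    rw [hf₀] at h1
    rw [h1, LFunction_smul] at h2
    exact_mod_cast h2
  rw [hL] at hTak
  -- (T_val) along `E ~ W_m ~ W₀`
  have hiso : (freyCurve a b).IsIsogenous W₀ :=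
    (isIsogenous_smul (freyCurve a b) C).trans' hisoW
  have hval : (W₀.minimalDiscriminantNorm ℤ).factorization q ≤
      163 * ((freyCurve a b).minimalDiscriminantNorm ℤ).factorization q :=
    stub_valTransport h68 a b hab h0 q hq hq2 hqN' W₀ hiso
  -- (T_model) back to the Frey model
  obtain ⟨D₁', -, hdeg₁'⟩ := stub_smulTransportDeg C D₁
  have hscale : (C.u : ℚ).num.natAbs ≤ 2 := stub_freyScale a b hab h0 C hC
  have hD : D.deg ≤ 4 * D₁.modularDegree := by
    calc D.deg ≤ D₁'.deg := hDmin D₁'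
      _ = (C.u : ℚ).num.natAbs ^ 2 * D₁.deg := hdeg₁'
      _ ≤ 2 ^ 2 * D₁.deg := Nat.mul_le_mul_right _ (Nat.pow_le_pow_left hscale 2)
      _ = 4 * D₁.modularDegree := by norm_num [ModularParametrizationData.modularDegree]
  -- the chain in `ℕ`
  set ξ : ℕ := brandtXi M q (fun n => (freyCurve a b).LFunction n) with hξ
  set v : ℕ := ((freyCurve a b).minimalDiscriminantNorm ℤ).factorization q with hv
  have hchain : D.deg ≤ 4 * 163 * 163 * (ξ * v) :=
    calc D.deg ≤ 4 * D₁.modularDegree := hD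
      _ ≤ 4 * (163 * D₀.modularDegree) := Nat.mul_le_mul_left _ h163'
      _ ≤ 4 * (163 * (ξ * (W₀.minimalDiscriminantNorm ℤ).factorization q)) :=
          Nat.mul_le_mul_left _ (Nat.mul_le_mul_left _ hTak)
      _ ≤ 4 * (163 * (ξ * (163 * v))) :=
          Nat.mul_le_mul_left _ (Nat.mul_le_mul_left _ (Nat.mul_le_mul_left _ hval))
      _ = 4 * 163 * 163 * (ξ * v) := by ring
  -- to `ℝ`, inserting the idle `N^ε ≥ 1`
  have hN1 : (1 : ℝ) ≤ ((M * q : ℕ) : ℝ) := by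
    exact_mod_cast Nat.one_le_iff_ne_zero.mpr (NeZero.ne (M * q))
  have hrpow : (1 : ℝ) ≤ ((M * q : ℕ) : ℝ) ^ ε := Real.one_le_rpow hN1 hε.le
  have hcast : (D.deg : ℝ) ≤ (4 * 163 * 163 : ℝ) * ((ξ : ℝ) * (v : ℝ)) := by
    exact_mod_cast hchain
  have hξv : (0 : ℝ) ≤ (ξ : ℝ) * (v : ℝ) := by positivity
  calc (D.deg : ℝ) ≤ (4 * 163 * 163 : ℝ) * ((ξ : ℝ) * (v : ℝ)) := hcast
    _ = (4 * 163 * 163 : ℝ) * 1 * ((ξ : ℝ) * (v : ℝ)) := by ring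
    _ ≤ (4 * 163 * 163 : ℝ) * ((M * q : ℕ) : ℝ) ^ ε * ((ξ : ℝ) * (v : ℝ)) := by gcongr

/-- **A3 on the Mazur–Kenku trust base**: twin + `163`-fact + Mazur–Kenku (Lemma 6.8 is a tree
theorem over `mazurKenku_exists_cyclic_isogeny`). [cite: Mazur1978, Thm. 1] [cite: Kenku1982] -/
theorem definiteRTControlPrime_of_twin_of_mazurKenku (hT : takahashi2001_thm_2_3_shimura_level)
    (h163 : PastenShimura2024_minimalDegree_le_163_mul) (hMK : mazurKenku_exists_cyclic_isogeny) :
    DefiniteRTControlPrime :=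
  definiteRTControlPrime_of_twin hT h163 (PastenShimura2024_lemma_6_8_of_mazurKenku' hMK)

end Summit.ABC.ABC.Cruxes.DefiniteRTControlPrime.StubIdeas1G4

end
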